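/-
Copyright (c) 2026. Released under Apache 2.0 license.
-/
import Literature.NumberTheory.Automorphic.UnboundedDenominatorsTwoLayer
import HarnessLib

/-!
# The invariant form of CDT Cor. 4.5.3: Step A of the depth step at `p = 2`

Let `2 ∣ M`, `N = 2M`, and let `θ : Γ(2M) → Q` be an `SL₂(ℤ)`-conjugation-invariant homomorphism which is
trivial on the commutators `[x, y]`, `x, y ∈ Γ(M)` (they lie in `Γ(2M)` because `2 ∣ M`), so that the image
`Â` of `Γ(M)` in `G = SL₂(ℤ)/K_θ` is abelian.  With `u_E = T^M`, `u_F = S u_E S⁻¹`, `u_H = T u_F T⁻¹` and the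
lift `h₀ = u_E u_F u_H⁻¹ ∈ Γ(M)` of `H = diag(1+M, 1-M)`, **`θ` maps `Γ(2M) ∩ ([SL₂(ℤ), Γ(M)]·K_θ)` into the
powers of the single `2`-torsion value `θ[T, h₀]`** (`exists_zpow_of_mem_commutator_two_layer`).  This is the
`p = 2` analogue of `map_eq_one_of_mem_commutator_top_layer` (odd `p`, where the corresponding value is `1`):
`[G, Â] = [T̂, Â]·[Ŝ, Â]`; in layer coordinates `𝔰𝔩₂(𝔽₂)` a central `[T̂, â₁][Ŝ, â₂]` equals
`[T̂, ĥ₀]^{-i}[Ŝ, ĥ₀]^{-i'}`; and `g ↦ θ[g, h₀]` is a character of `SL₂(ℤ)` (every `[g, h₀]` lies in `Γ(2M)`),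
so the relation `(ST)³ = S²` together with `θ[T, h₀]² = 1` forces `θ[S, h₀] = θ[T, h₀]`.  The residual value
`θ[T, h₀]` is genuinely nonzero for the `ℤ/2`-extension detected by the Schur multiplier of `SL₂(ℤ/2^e)`
([Beyl1986]); it is removed in the assembly by an auxiliary `ℤ/2`-character.
[cite: CalegariDimitrovTang2025, Corollary 4.5.3] [cite: Beyl1986, Theorem]
-/

open scoped MatrixGroups commutatorElement

namespace Literature.NumberTheory.Automorphic

namespace UnboundedDenominators

open CongruenceSubgroup Matrix.SpecialLinearGroup ModularGroup

variable {Q : Type*} [CommGroup Q]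

/-- `Γ(L) ≤ Γ(M)` for `M ∣ L`. [folklore] -/
private theorem Gamma_le_Gamma_of_dvd₁₅ {M L : ℕ} (h : M ∣ L) : Gamma L ≤ Gamma M := by
  intro γ hγ
  obtain ⟨h00, h01, h10, h11⟩ := Gamma_mem.mp hγ
  have cast_eq : ∀ a : ℤ, ((a : ZMod L).cast : ZMod M) = (a : ZMod M) := fun a ↦
    ZMod.cast_intCast h a
  rw [Gamma_mem]
  refine ⟨?_, ?_, ?_, ?_⟩
  · rw [← cast_eq, h00, ZMod.cast_one h]
  · rw [← cast_eq, h01, ZMod.cast_zero]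
  · rw [← cast_eq, h10, ZMod.cast_zero]
  · rw [← cast_eq, h11, ZMod.cast_one h]

/-- `T^M ∈ Γ(M)`. [folklore] -/
private theorem T_pow_mem_Gamma₅ (M : ℕ) : T ^ M ∈ Gamma M := by
  have := ModularGroup_T_pow_mem_Gamma (M : ℤ) (M : ℤ) (dvd_refl _)
  rwa [zpow_natCast, Int.natAbs_natCast] at this

/-- `S² = -1` is central in `SL₂(ℤ)`. [folklore] -/
private theorem S_mul_S_comm₅ (g : SL(2, ℤ)) : S * S * g = g * (S * S) := by
  have hS2 : (S : Matrix (Fin 2) (Fin 2) ℤ) * (S : Matrix (Fin 2) (Fin 2) ℤ) = -1 := by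
    rw [coe_S]
    ext i j
    fin_cases i <;> fin_cases j <;> simp [Matrix.mul_apply, Fin.sum_univ_two]
  apply Subtype.ext
  simp only [Matrix.SpecialLinearGroup.coe_mul]
  rw [hS2, neg_one_mul, mul_neg_one]

/-- The modular relation `(ST)³ = S²` in `SL₂(ℤ)`. [folklore] -/
private theorem S_T_rel₅ : S * T * (S * T) * (S * T) = S * S := by
  apply Subtype.ext
  simp only [Matrix.SpecialLinearGroup.coe_mul, coe_S, coe_T]
  ext i j
  fin_cases i <;> fin_cases j <;> simp [Matrix.mul_apply, Fin.sum_univ_two]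

/-- **Step A of the depth step at `p = 2`.**  Let `M ≠ 0`, `2 ∣ M`, and let `θ : Γ(2M) → Q` be
`SL₂(ℤ)`-conjugation-invariant and trivial on the commutators `[x, y]`, `x, y ∈ Γ(M)`, lying in `Γ(2M)`.
Put `h₀ = T^M (S T^M S⁻¹) (T (S T^M S⁻¹) T⁻¹)⁻¹`.  Then `[T, h₀] ∈ Γ(2M)`, `θ[T, h₀]² = 1`, and for every
`y ∈ Γ(2M) ∩ ([SL₂(ℤ), Γ(M)] · K_θ)` the value `θ(y)` is a power of `θ[T, h₀]`.
[cite: CalegariDimitrovTang2025, Corollary 4.5.3] [cite: Beyl1986, Theorem] -/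
theorem exists_zpow_of_mem_commutator_two_layer {M : ℕ} (hM : M ≠ 0) (hM2 : 2 ∣ M)
    (θ : Gamma (M * 2) →* Q)
    (hθ : ∀ (g x : SL(2, ℤ)) (hx : x ∈ Gamma (M * 2)) (hgx : g * x * g⁻¹ ∈ Gamma (M * 2)),
      θ ⟨g * x * g⁻¹, hgx⟩ = θ ⟨x, hx⟩)
    (hab : ∀ (x y : SL(2, ℤ)) (hx : x ∈ Gamma M) (hy : y ∈ Gamma M) (hxy : ⁅x, y⁆ ∈ Gamma (M * 2)),
      θ ⟨⁅x, y⁆, hxy⟩ = 1) :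
    ∃ h0 : ⁅T, T ^ M * (S * T ^ M * S⁻¹) * (T * (S * T ^ M * S⁻¹) * T⁻¹)⁻¹⁆ ∈ Gamma (M * 2),
      θ ⟨_, h0⟩ ^ 2 = 1 ∧
      ∀ (y : SL(2, ℤ)) (hy : y ∈ Gamma (M * 2)),
        y ∈ ⁅(⊤ : Subgroup SL(2, ℤ)), Gamma M⁆ ⊔ θ.ker.map (Gamma (M * 2)).subtype →
        ∃ i : ℤ, θ ⟨y, hy⟩ = θ ⟨_, h0⟩ ^ i := by
  classical
  haveI := ker_map_subtype_normal θ hθ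
  haveI := Gamma_normal (M * 2)
  haveI := Gamma_normal M
  set K : Subgroup SL(2, ℤ) := θ.ker.map (Gamma (M * 2)).subtype with hKdef
  set π : SL(2, ℤ) →* SL(2, ℤ) ⧸ K := QuotientGroup.mk' K with hπ
  have hNA : Gamma (M * 2) ≤ Gamma M := Gamma_le_Gamma_of_dvd₁₅ (dvd_mul_right M 2)
  -- `Â` is abelian
  have hAcomm : ∀ {u v : SL(2, ℤ)}, u ∈ Gamma M → v ∈ Gamma M → ⁅π u, π v⁆ = 1 := by
    intro u v hu hv
    have huv : ⁅u, v⁆ ∈ Gamma (M * 2) := commutatorElement_mem_Gamma_two_mul hM2 hu hv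
    have h := hab u v hu hv huv
    rw [← map_commutatorElement, hπ, QuotientGroup.mk'_apply, QuotientGroup.eq_one_iff]
    exact (mem_ker_map_subtype_iff θ).mpr ⟨huv, h⟩
  -- transport between `θ` and `π` on `Γ(2M)`
  have hπθ : ∀ (u v : SL(2, ℤ)) (hu : u ∈ Gamma (M * 2)) (hv : v ∈ Gamma (M * 2)), π u = π v →
      θ ⟨u, hu⟩ = θ ⟨v, hv⟩ := by
    intro u v hu hv h
    rw [hπ, QuotientGroup.mk'_apply, QuotientGroup.mk'_apply, QuotientGroup.eq] at h
    obtain ⟨_, h1⟩ := (mem_ker_map_subtype_iff θ).mp h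
    have h2 : (⟨u⁻¹ * v, mul_mem (inv_mem hu) hv⟩ : Gamma (M * 2)) = ⟨u, hu⟩⁻¹ * ⟨v, hv⟩ := rfl
    rw [h2, map_mul, map_inv, inv_mul_eq_one] at h1
    exact h1
  have hθπ : ∀ (u v : SL(2, ℤ)) (hu : u ∈ Gamma (M * 2)) (hv : v ∈ Gamma (M * 2)), θ ⟨u, hu⟩ = θ ⟨v, hv⟩ →
      π u = π v := by
    intro u v hu hv h
    rw [hπ, QuotientGroup.mk'_apply, QuotientGroup.mk'_apply, QuotientGroup.eq]
    refine (mem_ker_map_subtype_iff θ).mpr ⟨mul_mem (inv_mem hu) hv, ?_⟩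
    have h2 : (⟨u⁻¹ * v, mul_mem (inv_mem hu) hv⟩ : Gamma (M * 2)) = ⟨u, hu⟩⁻¹ * ⟨v, hv⟩ := rfl
    rw [h2, map_mul, map_inv, h, inv_mul_cancel]
  -- the quotient: basic facts
  have hπone : ∀ (w : SL(2, ℤ)) (hw : w ∈ Gamma (M * 2)), π w = 1 → θ ⟨w, hw⟩ = 1 := by
    intro w hw h1
    rw [hπ, QuotientGroup.mk'_apply, QuotientGroup.eq_one_iff] at h1
    obtain ⟨_, h⟩ := (mem_ker_map_subtype_iff θ).mp h1
    exact h
  have hZmem : ∀ w : SL(2, ℤ), π w = 1 → w ∈ Gamma (M * 2) := by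
    intro w hw
    rw [hπ, QuotientGroup.mk'_apply, QuotientGroup.eq_one_iff] at hw
    exact ker_map_subtype_le θ hw
  have hcentralN : ∀ w ∈ Gamma (M * 2), ∀ g : SL(2, ℤ) ⧸ K, ⁅g, π w⁆ = 1 := by
    intro w hw g
    have hc' : π w ∈ Subgroup.center (SL(2, ℤ) ⧸ K) := mk_mem_center_of_mem_Gamma θ hθ hw
    rw [commutatorElement_def, Subgroup.mem_center_iff.mp hc' g]; group
  have hAcomm' : ∀ {u v : SL(2, ℤ)}, u ∈ Gamma M → v ∈ Gamma M → π u * π v = π v * π u :=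
    fun {u v} hu hv ↦ commutatorElement_eq_one_iff_mul_comm.mp (hAcomm hu hv)
  -- `δ_g(a) = [g, a]` on the top layer: homomorphisms killing `Γ(N)`, with `p`-torsion values
  have hδmem : ∀ (g a : SL(2, ℤ)), a ∈ Gamma M → ⁅g, a⁆ ∈ Gamma M := by
    intro g a ha
    rw [commutatorElement_def]
    exact mul_mem ((Gamma_normal _).conj_mem a ha g) (inv_mem ha)
  have hδmul : ∀ (g a b : SL(2, ℤ)), a ∈ Gamma M → b ∈ Gamma M →
      π ⁅g, a * b⁆ = π ⁅g, a⁆ * π ⁅g, b⁆ := by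
    intro g a b ha hb
    have h1 : ⁅g, a * b⁆ = ⁅g, a⁆ * (a * ⁅g, b⁆ * a⁻¹) := by simp only [commutatorElement_def]; group
    rw [h1, map_mul, map_mul, map_mul, map_inv, hAcomm' ha (hδmem g b hb), mul_inv_cancel_right]
  have hδone : ∀ (g a : SL(2, ℤ)), a ∈ Gamma (M * 2) → π ⁅g, a⁆ = 1 := by
    intro g a ha
    rw [map_commutatorElement]
    exact hcentralN a ha (π g)
  have hδinv : ∀ (g a : SL(2, ℤ)), a ∈ Gamma M → π ⁅g, a⁻¹⁆ = (π ⁅g, a⁆)⁻¹ := by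
    intro g a ha
    have h := hδmul g a a⁻¹ ha (inv_mem ha)
    rw [mul_inv_cancel, commutatorElement_one_right, map_one] at h
    exact (inv_eq_of_mul_eq_one_right h.symm).symm
  have hδpow : ∀ (g a : SL(2, ℤ)), a ∈ Gamma M → ∀ k : ℕ, π ⁅g, a ^ k⁆ = π ⁅g, a⁆ ^ k := by
    intro g a ha k
    induction k with
    | zero => simp
    | succ k ih => rw [pow_succ, hδmul g _ _ (pow_mem ha k) ha, ih, pow_succ]
  have hδzpow : ∀ (g a : SL(2, ℤ)), a ∈ Gamma M → ∀ k : ℤ, π ⁅g, a ^ k⁆ = π ⁅g, a⁆ ^ k := by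
    intro g a ha k
    rcases Int.eq_nat_or_neg k with ⟨l, rfl | rfl⟩
    · rw [zpow_natCast, zpow_natCast, hδpow g a ha]
    · rw [zpow_neg, zpow_natCast, zpow_neg, zpow_natCast, hδinv g _ (pow_mem ha l), hδpow g a ha]
  have hδtors : ∀ (g a : SL(2, ℤ)), a ∈ Gamma M → π ⁅g, a⁆ ^ 2 = 1 := by
    intro g a ha
    have hap : a ^ 2 ∈ Gamma (M * 2) := pow_mem_Gamma_mul_of_dvd hM2 ha
    rw [← hδpow g a ha, hδone g _ hap]
  -- congruence mod `Γ(N)` does not change `π [g, ·]`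
  have hδcongr : ∀ (g a b : SL(2, ℤ)), a ∈ Gamma M → b ∈ Gamma M →
      a * b⁻¹ ∈ Gamma (M * 2) → π ⁅g, a⁆ = π ⁅g, b⁆ := by
    intro g a b ha hb hab
    have h := hδmul g (a * b⁻¹) b (hNA hab) hb
    rw [inv_mul_cancel_right, hδone g _ hab, one_mul] at h
    exact h
  -- `[G, Â] = [T̂, Â] · [Ŝ, Â]`: every `π [g, a]` is `π [T, a₁] · π [S, a₂]`
  have hdecomp : ∀ (g a : SL(2, ℤ)), a ∈ Gamma M →
      ∃ a₁ a₂ : SL(2, ℤ), a₁ ∈ Gamma M ∧ a₂ ∈ Gamma M ∧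
        π ⁅g, a⁆ = π ⁅T, a₁⁆ * π ⁅S, a₂⁆ := by
    intro g
    have hg : g ∈ Subgroup.closure ({S, T} : Set SL(2, ℤ)) := by
      rw [SpecialLinearGroup.SL2Z_generators]; exact Subgroup.mem_top g
    induction hg using Subgroup.closure_induction with
    | mem x hx =>
      intro a ha
      rcases hx with rfl | rfl
      · exact ⟨1, a, one_mem _, ha, by rw [commutatorElement_one_right, map_one, one_mul]⟩
      · exact ⟨a, 1, ha, one_mem _, by rw [commutatorElement_one_right, map_one, mul_one]⟩
    | one =>
      intro a ha
      exact ⟨1, 1, one_mem _, one_mem _, by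
        rw [commutatorElement_one_left, commutatorElement_one_right, commutatorElement_one_right, map_one,
          mul_one]⟩
    | mul x y _ _ ihx ihy =>
      intro a ha
      have hya : y * a * y⁻¹ ∈ Gamma M := (Gamma_normal _).conj_mem a ha y
      obtain ⟨a₁, a₂, ha₁, ha₂, h1⟩ := ihx (y * a * y⁻¹) hya
      obtain ⟨b₁, b₂, hb₁, hb₂, h2⟩ := ihy a ha
      refine ⟨a₁ * b₁, a₂ * b₂, mul_mem ha₁ hb₁, mul_mem ha₂ hb₂, ?_⟩
      rw [show ⁅x * y, a⁆ = ⁅x, y * a * y⁻¹⁆ * ⁅y, a⁆ by simp only [commutatorElement_def]; group, map_mul, h1,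
        h2, hδmul T a₁ b₁ ha₁ hb₁, hδmul S a₂ b₂ ha₂ hb₂]
      have hc : π ⁅S, a₂⁆ * π ⁅T, b₁⁆ = π ⁅T, b₁⁆ * π ⁅S, a₂⁆ :=
        hAcomm' (hδmem S a₂ ha₂) (hδmem T b₁ hb₁)
      calc π ⁅T, a₁⁆ * π ⁅S, a₂⁆ * (π ⁅T, b₁⁆ * π ⁅S, b₂⁆)
          = π ⁅T, a₁⁆ * (π ⁅S, a₂⁆ * π ⁅T, b₁⁆) * π ⁅S, b₂⁆ := by group
        _ = π ⁅T, a₁⁆ * (π ⁅T, b₁⁆ * π ⁅S, a₂⁆) * π ⁅S, b₂⁆ := by rw [hc]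
        _ = π ⁅T, a₁⁆ * π ⁅T, b₁⁆ * (π ⁅S, a₂⁆ * π ⁅S, b₂⁆) := by group
    | inv x _ ih =>
      intro a ha
      have hxa : x⁻¹ * a * x ∈ Gamma M := by
        simpa using (Gamma_normal M).conj_mem a ha x⁻¹
      obtain ⟨a₁, a₂, ha₁, ha₂, h1⟩ := ih (x⁻¹ * a * x) hxa
      refine ⟨a₁⁻¹, a₂⁻¹, inv_mem ha₁, inv_mem ha₂, ?_⟩
      rw [show ⁅x⁻¹, a⁆ = ⁅x, x⁻¹ * a * x⁆⁻¹ by simp only [commutatorElement_def]; group, map_inv, h1,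
        hδinv T a₁ ha₁, hδinv S a₂ ha₂, mul_inv_rev]
      have hc := hAcomm' (hδmem S a₂ ha₂) (hδmem T a₁ ha₁)
      rw [← mul_inv_rev, ← mul_inv_rev, hc]
  -- the subgroup `M = {π[T,a₁] π[S,a₂]}` contains `π [SL₂(ℤ), Γ_{n+1}]`
  have hMmul : ∀ (a₁ a₂ b₁ b₂ : SL(2, ℤ)), a₁ ∈ Gamma M → a₂ ∈ Gamma M →
      b₁ ∈ Gamma M → b₂ ∈ Gamma M →
      π ⁅T, a₁⁆ * π ⁅S, a₂⁆ * (π ⁅T, b₁⁆ * π ⁅S, b₂⁆) = π ⁅T, a₁ * b₁⁆ * π ⁅S, a₂ * b₂⁆ := by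
    intro a₁ a₂ b₁ b₂ ha₁ ha₂ hb₁ hb₂
    have hc : π ⁅S, a₂⁆ * π ⁅T, b₁⁆ = π ⁅T, b₁⁆ * π ⁅S, a₂⁆ :=
      hAcomm' (hδmem S a₂ ha₂) (hδmem T b₁ hb₁)
    rw [hδmul T a₁ b₁ ha₁ hb₁, hδmul S a₂ b₂ ha₂ hb₂]
    calc π ⁅T, a₁⁆ * π ⁅S, a₂⁆ * (π ⁅T, b₁⁆ * π ⁅S, b₂⁆)
        = π ⁅T, a₁⁆ * (π ⁅S, a₂⁆ * π ⁅T, b₁⁆) * π ⁅S, b₂⁆ := by group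
      _ = π ⁅T, a₁⁆ * (π ⁅T, b₁⁆ * π ⁅S, a₂⁆) * π ⁅S, b₂⁆ := by rw [hc]
      _ = π ⁅T, a₁⁆ * π ⁅T, b₁⁆ * (π ⁅S, a₂⁆ * π ⁅S, b₂⁆) := by group
  have hyM : ∀ (y : SL(2, ℤ)), y ∈ ⁅(⊤ : Subgroup SL(2, ℤ)), Gamma M⁆ →
      ∃ a₁ a₂ : SL(2, ℤ), a₁ ∈ Gamma M ∧ a₂ ∈ Gamma M ∧
        π y = π ⁅T, a₁⁆ * π ⁅S, a₂⁆ := by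
    -- the explicit subgroup
    let Msub : Subgroup (SL(2, ℤ) ⧸ K) :=
      { carrier := {z | ∃ a₁ a₂ : SL(2, ℤ), a₁ ∈ Gamma M ∧
          a₂ ∈ Gamma M ∧ z = π ⁅T, a₁⁆ * π ⁅S, a₂⁆}
        mul_mem' := by
          rintro _ _ ⟨a₁, a₂, ha₁, ha₂, rfl⟩ ⟨b₁, b₂, hb₁, hb₂, rfl⟩
          exact ⟨a₁ * b₁, a₂ * b₂, mul_mem ha₁ hb₁, mul_mem ha₂ hb₂, hMmul a₁ a₂ b₁ b₂ ha₁ ha₂ hb₁ hb₂⟩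
        one_mem' := ⟨1, 1, one_mem _, one_mem _, by
          rw [commutatorElement_one_right, commutatorElement_one_right, map_one, mul_one]⟩
        inv_mem' := by
          rintro _ ⟨a₁, a₂, ha₁, ha₂, rfl⟩
          refine ⟨a₁⁻¹, a₂⁻¹, inv_mem ha₁, inv_mem ha₂, ?_⟩
          have hc := hAcomm' (hδmem S a₂ ha₂) (hδmem T a₁ ha₁)
          rw [hδinv T a₁ ha₁, hδinv S a₂ ha₂, mul_inv_rev, ← mul_inv_rev, ← mul_inv_rev, hc] }
    have hle : (⁅(⊤ : Subgroup SL(2, ℤ)), Gamma M⁆).map π ≤ Msub := by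
      rw [Subgroup.map_commutator, Subgroup.commutator_le]
      rintro _ ⟨g, -, rfl⟩ _ ⟨a, ha, rfl⟩
      obtain ⟨a₁, a₂, ha₁, ha₂, h⟩ := hdecomp g a ha
      exact ⟨a₁, a₂, ha₁, ha₂, by rw [← map_commutatorElement, h]⟩
    intro y hy
    obtain ⟨a₁, a₂, ha₁, ha₂, h⟩ := hle ⟨y, hy, rfl⟩
    exact ⟨a₁, a₂, ha₁, ha₂, h⟩
  -- layer coordinates at the top layer and the generators `u_E, u_F, u_H`
  obtain ⟨Φ, -, P2, P3, P4, P5, P6, P7⟩ := exists_layerCoord_mul M 2 hM hM2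
  set uE : SL(2, ℤ) := T ^ M with huE
  set uF : SL(2, ℤ) := S * uE * S⁻¹ with huF
  set uH : SL(2, ℤ) := T * uF * T⁻¹ with huH
  have mE : uE ∈ Gamma M := T_pow_mem_Gamma₅ _
  have mF : uF ∈ Gamma M := (Gamma_normal _).conj_mem _ mE S
  have mH : uH ∈ Gamma M := (Gamma_normal _).conj_mem _ mF T
  have t00 : ((T : SL(2, ℤ)) 0 0 : ℤ) = 1 := by simp [coe_T]
  have t01 : ((T : SL(2, ℤ)) 0 1 : ℤ) = 1 := by simp [coe_T]
  have t10 : ((T : SL(2, ℤ)) 1 0 : ℤ) = 0 := by simp [coe_T]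
  have t11 : ((T : SL(2, ℤ)) 1 1 : ℤ) = 1 := by simp [coe_T]
  have s00 : ((S : SL(2, ℤ)) 0 0 : ℤ) = 0 := by simp [coe_S]
  have s01 : ((S : SL(2, ℤ)) 0 1 : ℤ) = -1 := by simp [coe_S]
  have s10 : ((S : SL(2, ℤ)) 1 0 : ℤ) = 1 := by simp [coe_S]
  have s11 : ((S : SL(2, ℤ)) 1 1 : ℤ) = 0 := by simp [coe_S]
  have ΦE : Φ ⟨uE, mE⟩ = Multiplicative.ofAdd (0, 1, 0) := P5 mE
  have ΦF : Φ ⟨uF, mF⟩ = Multiplicative.ofAdd (0, 0, -1) := P6 mF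
  have ΦH : Φ ⟨uH, mH⟩ = Multiplicative.ofAdd (-1, 1, -1) := by
    have h4 := P4 T uF mF mH 0 0 (-1) ΦF
    rw [t00, t01, t10, t11] at h4
    push_cast at h4
    exact h4.trans (congrArg _ (by decide))
  -- the Ad-formulas for `T` and `S` on coordinates
  have ΦT : ∀ (a : SL(2, ℤ)) (ha : a ∈ Gamma M) (α β κ : ZMod 2),
      Φ ⟨a, ha⟩ = Multiplicative.ofAdd (α, β, κ) →
      Φ ⟨⁅T, a⁆, hδmem T a ha⟩ = Multiplicative.ofAdd (κ, -κ - 2 * α, 0) := by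
    intro a ha α β κ h
    have hTa : T * a * T⁻¹ ∈ Gamma M := (Gamma_normal _).conj_mem a ha T
    have h1 := P4 T a ha hTa α β κ h
    rw [t00, t01, t10, t11] at h1
    have h2 : (⟨⁅T, a⁆, hδmem T a ha⟩ : Gamma M) = ⟨T * a * T⁻¹, hTa⟩ * ⟨a, ha⟩⁻¹ :=
      Subtype.ext (by simp [commutatorElement_def])
    rw [h2, map_mul, map_inv, h1, h, ← ofAdd_neg, ← ofAdd_add]
    congr 1
    push_cast
    rw [Prod.neg_mk, Prod.neg_mk, Prod.mk_add_mk, Prod.mk_add_mk, Prod.mk.injEq, Prod.mk.injEq]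
    exact ⟨by ring, by ring, by ring⟩
  have ΦS : ∀ (a : SL(2, ℤ)) (ha : a ∈ Gamma M) (α β κ : ZMod 2),
      Φ ⟨a, ha⟩ = Multiplicative.ofAdd (α, β, κ) →
      Φ ⟨⁅S, a⁆, hδmem S a ha⟩ = Multiplicative.ofAdd (-2 * α, -κ - β, -β - κ) := by
    intro a ha α β κ h
    have hSa : S * a * S⁻¹ ∈ Gamma M := (Gamma_normal _).conj_mem a ha S
    have h1 := P4 S a ha hSa α β κ h
    rw [s00, s01, s10, s11] at h1
    have h2 : (⟨⁅S, a⁆, hδmem S a ha⟩ : Gamma M) = ⟨S * a * S⁻¹, hSa⟩ * ⟨a, ha⟩⁻¹ :=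
      Subtype.ext (by simp [commutatorElement_def])
    rw [h2, map_mul, map_inv, h1, h, ← ofAdd_neg, ← ofAdd_add]
    congr 1
    push_cast
    rw [Prod.neg_mk, Prod.neg_mk, Prod.mk_add_mk, Prod.mk_add_mk, Prod.mk.injEq, Prod.mk.injEq]
    exact ⟨by ring, by ring, by ring⟩
  -- exact relations: `[T, u_E] = 1`, `[S, u_E u_F] = [u_F, u_E] = 1`
  have ζE : π ⁅T, uE⁆ = 1 := by
    rw [huE, commutatorElement_eq_one_iff_mul_comm.mpr ((Commute.refl T).pow_right _).eq, map_one]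
  have ζEF : π ⁅S, uE⁆ * π ⁅S, uF⁆ = 1 := by
    rw [← hδmul S uE uF mE mF]
    have h1 : ⁅S, uE * uF⁆ = ⁅uF, uE⁆ := by
      rw [huF, commutatorElement_def, commutatorElement_def,
        show S * (uE * (S * uE * S⁻¹)) * S⁻¹ * (uE * (S * uE * S⁻¹))⁻¹ =
          (S * uE * S⁻¹) * (S * S * uE * (S * S)⁻¹) * (S * uE * S⁻¹)⁻¹ * uE⁻¹ by group,
        S_mul_S_comm₅ uE, mul_inv_cancel_right]
    rw [h1]
    exact hAcomm mF mE
  have ζF : π ⁅S, uF⁆ = (π ⁅S, uE⁆)⁻¹ := (inv_eq_of_mul_eq_one_right ζEF).symm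
  -- exponents only matter mod `2`
  have hzmod : ∀ (x : SL(2, ℤ) ⧸ K), x ^ 2 = 1 → ∀ (u v : ℤ), (u : ZMod 2) = (v : ZMod 2) → x ^ u = x ^ v := by
    intro x hx u v huv
    obtain ⟨c, hc⟩ := (ZMod.intCast_eq_intCast_iff_dvd_sub u v 2).mp huv
    push_cast at hc
    rw [show v = u + 2 * c by linear_combination hc, zpow_add, zpow_mul, zpow_ofNat, hx, one_zpow,
      mul_one]
  have h20 : (2 : ZMod 2) = 0 := by decide
  -- the lift `h₀` of `H = diag(1+M, 1-M)`
  set h₀ : SL(2, ℤ) := uE * uF * uH⁻¹ with hh₀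
  have mh₀ : h₀ ∈ Gamma M := mul_mem (mul_mem mE mF) (inv_mem mH)
  have Φh₀ : Φ ⟨h₀, mh₀⟩ = Multiplicative.ofAdd (1, 0, 0) := by
    have h3 : (⟨h₀, mh₀⟩ : Gamma M) = ⟨uE, mE⟩ * ⟨uF, mF⟩ * ⟨uH, mH⟩⁻¹ := rfl
    rw [h3, map_mul, map_mul, map_inv, ΦE, ΦF, ΦH, ← ofAdd_add, ← ofAdd_neg, ← ofAdd_add]
    congr 1
  -- every `[g, h₀]` lies in `Γ(2M)`: `Ad(g)` fixes the class of `H` mod `2`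
  have hgh₀ : ∀ g : SL(2, ℤ), ⁅g, h₀⁆ ∈ Gamma (M * 2) := by
    intro g
    have mg : g * h₀ * g⁻¹ ∈ Gamma M := (Gamma_normal _).conj_mem _ mh₀ g
    have h4 := P4 g h₀ mh₀ mg 1 0 0 Φh₀
    have hdet : (g 0 0 : ℤ) * g 1 1 - g 0 1 * g 1 0 = 1 := by
      have h := Matrix.det_fin_two (g : Matrix (Fin 2) (Fin 2) ℤ)
      rw [g.det_coe] at h
      linear_combination -h
    have hdet' : ((g 0 0 : ℤ) : ZMod 2) * ((g 1 1 : ℤ) : ZMod 2) -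
        ((g 0 1 : ℤ) : ZMod 2) * ((g 1 0 : ℤ) : ZMod 2) = 1 := by
      have h := congrArg (Int.cast : ℤ → ZMod 2) hdet
      push_cast at h
      exact h
    have hΦg : Φ ⟨g * h₀ * g⁻¹, mg⟩ = Φ ⟨h₀, mh₀⟩ := by
      rw [h4, Φh₀]
      congr 1
      simp only [Prod.mk.injEq]
      refine ⟨?_, ?_, ?_⟩
      · linear_combination hdet' + (((g 0 1 : ℤ) : ZMod 2) * ((g 1 0 : ℤ) : ZMod 2)) * h20
      · linear_combination (-(((g 0 0 : ℤ) : ZMod 2) * ((g 0 1 : ℤ) : ZMod 2))) * h20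
      · linear_combination (((g 1 0 : ℤ) : ZMod 2) * ((g 1 1 : ℤ) : ZMod 2)) * h20
    have h2 : (⟨⁅g, h₀⁆, hδmem g h₀ mh₀⟩ : Gamma M) = ⟨g * h₀ * g⁻¹, mg⟩ * ⟨h₀, mh₀⟩⁻¹ :=
      Subtype.ext (by simp [commutatorElement_def])
    exact P3 _ (hδmem g h₀ mh₀) (by rw [h2, map_mul, map_inv, hΦg, mul_inv_cancel])
  -- `θ[T, h₀]² = 1`
  have hT2 : θ ⟨⁅T, h₀⁆, hgh₀ T⟩ ^ 2 = 1 := by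
    have h1 : π (⁅T, h₀⁆ ^ 2) = π 1 := by rw [map_pow, hδtors T h₀ mh₀, map_one]
    have h2 := hπθ _ _ (pow_mem (hgh₀ T) 2) (one_mem _) h1
    have h4 : (⟨1, one_mem _⟩ : Gamma (M * 2)) = 1 := rfl
    rw [h4, map_one] at h2
    have h3 : (⟨⁅T, h₀⁆ ^ 2, pow_mem (hgh₀ T) 2⟩ : Gamma (M * 2)) = ⟨⁅T, h₀⁆, hgh₀ T⟩ ^ 2 := rfl
    rw [h3, map_pow] at h2
    exact h2
  -- the character `g ↦ θ[g, h₀]` of `SL₂(ℤ)` and the relation `(ST)³ = S²`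
  have hχmul : ∀ g₁ g₂ : SL(2, ℤ),
      θ ⟨⁅g₁ * g₂, h₀⁆, hgh₀ _⟩ = θ ⟨⁅g₂, h₀⁆, hgh₀ _⟩ * θ ⟨⁅g₁, h₀⁆, hgh₀ _⟩ := by
    intro g₁ g₂
    have hc : g₁ * ⁅g₂, h₀⁆ * g₁⁻¹ ∈ Gamma (M * 2) := (Gamma_normal _).conj_mem _ (hgh₀ g₂) g₁
    have hval : ⁅g₁ * g₂, h₀⁆ = g₁ * ⁅g₂, h₀⁆ * g₁⁻¹ * ⁅g₁, h₀⁆ := by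
      simp only [commutatorElement_def]; group
    have h1 : (⟨⁅g₁ * g₂, h₀⁆, hgh₀ _⟩ : Gamma (M * 2)) = ⟨g₁ * ⁅g₂, h₀⁆ * g₁⁻¹, hc⟩ * ⟨⁅g₁, h₀⁆, hgh₀ _⟩ :=
      Subtype.ext hval
    rw [h1, map_mul, hθ g₁ _ (hgh₀ g₂) hc]
  have hST : θ ⟨⁅S, h₀⁆, hgh₀ S⟩ = θ ⟨⁅T, h₀⁆, hgh₀ T⟩ := by
    have h1 : θ ⟨⁅S * T * (S * T) * (S * T), h₀⁆, hgh₀ _⟩ = θ ⟨⁅S * S, h₀⁆, hgh₀ _⟩ := by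
      have h : (⟨⁅S * T * (S * T) * (S * T), h₀⁆, hgh₀ _⟩ : Gamma (M * 2)) = ⟨⁅S * S, h₀⁆, hgh₀ _⟩ :=
        Subtype.ext (by rw [S_T_rel₅])
      rw [h]
    rw [hχmul (S * T * (S * T)) (S * T), hχmul (S * T) (S * T), hχmul S T, hχmul S S] at h1
    -- `h1 : (cT cS) * ((cT cS) * (cT cS)) = cS * cS`
    have h3 : (θ ⟨⁅T, h₀⁆, hgh₀ T⟩ * θ ⟨⁅S, h₀⁆, hgh₀ S⟩) ^ 3 = θ ⟨⁅S, h₀⁆, hgh₀ S⟩ ^ 2 := by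
      rw [pow_succ', pow_two, pow_two]
      exact h1
    rw [mul_pow] at h3
    have ha3 : θ ⟨⁅T, h₀⁆, hgh₀ T⟩ ^ 3 = θ ⟨⁅T, h₀⁆, hgh₀ T⟩ := by rw [pow_succ, hT2, one_mul]
    have h4 : θ ⟨⁅T, h₀⁆, hgh₀ T⟩ * θ ⟨⁅S, h₀⁆, hgh₀ S⟩ = 1 := by
      have h5 : θ ⟨⁅T, h₀⁆, hgh₀ T⟩ * θ ⟨⁅S, h₀⁆, hgh₀ S⟩ * θ ⟨⁅S, h₀⁆, hgh₀ S⟩ ^ 2 =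
          1 * θ ⟨⁅S, h₀⁆, hgh₀ S⟩ ^ 2 := by
        rw [one_mul, mul_assoc, ← pow_succ', ← ha3]
        exact h3
      exact mul_right_cancel h5
    have hTinv : (θ ⟨⁅T, h₀⁆, hgh₀ T⟩)⁻¹ = θ ⟨⁅T, h₀⁆, hgh₀ T⟩ :=
      inv_eq_of_mul_eq_one_right (by rw [← pow_two]; exact hT2)
    rw [← hTinv]
    exact eq_inv_of_mul_eq_one_right h4
  have hπST : π ⁅S, h₀⁆ = π ⁅T, h₀⁆ := hθπ _ _ (hgh₀ S) (hgh₀ T) hST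
  -- `π[T, h₀]` and `π[S, h₀]` in terms of the basic values
  have hw₁ : π ⁅T, h₀⁆ = π ⁅T, uF⁆ * (π ⁅T, uH⁆)⁻¹ := by
    rw [hh₀, hδmul T _ _ (mul_mem mE mF) (inv_mem mH), hδmul T _ _ mE mF, hδinv T uH mH, ζE, one_mul]
  have hw₂ : π ⁅S, h₀⁆ = (π ⁅S, uH⁆)⁻¹ := by
    rw [hh₀, hδmul S _ _ (mul_mem mE mF) (inv_mem mH), hδmul S _ _ mE mF, hδinv S uH mH, ζEF, one_mul]
  have hzS : π ⁅S, uH⁆ = (π ⁅T, h₀⁆)⁻¹ := by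
    rw [← hπST, hw₂, inv_inv]
  have cTH : Commute (π ⁅T, uH⁆) (π ⁅T, uF⁆) := hAcomm' (hδmem T uH mH) (hδmem T uF mF)
  have hwpow : ∀ n : ℤ, π ⁅T, h₀⁆ ^ n = π ⁅T, uF⁆ ^ n * (π ⁅T, uH⁆ ^ n)⁻¹ := by
    intro n
    rw [hw₁, (Commute.inv_right cTH.symm).mul_zpow, inv_zpow]
  -- CLAIM: a central `π[T,a₁] π[S,a₂]` is a power of `π[T, h₀]`
  have hclaim : ∀ (a₁ a₂ : SL(2, ℤ)) (ha₁ : a₁ ∈ Gamma M) (ha₂ : a₂ ∈ Gamma M),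
      ⁅T, a₁⁆ * ⁅S, a₂⁆ ∈ Gamma (M * 2) → ∃ i : ℤ, π ⁅T, a₁⁆ * π ⁅S, a₂⁆ = π ⁅T, h₀⁆ ^ i := by
    intro a₁ a₂ ha₁ ha₂ hmem
    obtain ⟨i, j, k, h1⟩ := P7 uH uE uF mH mE mF ΦH ΦE ΦF a₁ ha₁
    obtain ⟨i', j', k', h2⟩ := P7 uH uE uF mH mE mF ΦH ΦE ΦF a₂ ha₂
    have hg₁ : uH ^ i * uE ^ j * uF ^ k ∈ Gamma M :=
      mul_mem (mul_mem (zpow_mem mH i) (zpow_mem mE j)) (zpow_mem mF k)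
    have hg₂ : uH ^ i' * uE ^ j' * uF ^ k' ∈ Gamma M :=
      mul_mem (mul_mem (zpow_mem mH i') (zpow_mem mE j')) (zpow_mem mF k')
    -- coordinates of `a₁`, `a₂`
    have hΦg : ∀ (i j k : ℤ) (hg : uH ^ i * uE ^ j * uF ^ k ∈ Gamma M),
        Φ ⟨uH ^ i * uE ^ j * uF ^ k, hg⟩ =
          Multiplicative.ofAdd ((-i : ZMod 2), (i + j : ZMod 2), (-i - k : ZMod 2)) := by
      intro i j k hg
      have h3 : (⟨uH ^ i * uE ^ j * uF ^ k, hg⟩ : Gamma M) =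
          ⟨uH, mH⟩ ^ i * ⟨uE, mE⟩ ^ j * ⟨uF, mF⟩ ^ k := Subtype.ext (by simp)
      rw [h3, map_mul, map_mul, map_zpow, map_zpow, map_zpow, ΦH, ΦE, ΦF]
      apply Multiplicative.toAdd.injective
      simp only [toAdd_mul, toAdd_zpow, toAdd_ofAdd, Prod.smul_mk, Prod.mk_add_mk, zsmul_eq_mul,
        Prod.mk.injEq]
      exact ⟨by ring, by ring, by ring⟩
    have hΦa₁ : Φ ⟨a₁, ha₁⟩ = Φ ⟨uH ^ i * uE ^ j * uF ^ k, hg₁⟩ := by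
      have h3 := P2 _ (mul_mem ha₁ (inv_mem hg₁)) h1
      have h4 : (⟨a₁ * (uH ^ i * uE ^ j * uF ^ k)⁻¹, mul_mem ha₁ (inv_mem hg₁)⟩ :
          Gamma M) = ⟨a₁, ha₁⟩ * ⟨uH ^ i * uE ^ j * uF ^ k, hg₁⟩⁻¹ := rfl
      rw [h4, map_mul, map_inv, mul_inv_eq_one] at h3
      exact h3
    have hΦa₂ : Φ ⟨a₂, ha₂⟩ = Φ ⟨uH ^ i' * uE ^ j' * uF ^ k', hg₂⟩ := by
      have h3 := P2 _ (mul_mem ha₂ (inv_mem hg₂)) h2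
      have h4 : (⟨a₂ * (uH ^ i' * uE ^ j' * uF ^ k')⁻¹, mul_mem ha₂ (inv_mem hg₂)⟩ :
          Gamma M) = ⟨a₂, ha₂⟩ * ⟨uH ^ i' * uE ^ j' * uF ^ k', hg₂⟩⁻¹ := rfl
      rw [h4, map_mul, map_inv, mul_inv_eq_one] at h3
      exact h3
    rw [hΦg i j k hg₁] at hΦa₁
    rw [hΦg i' j' k' hg₂] at hΦa₂
    -- the equations from `Φ([T,a₁][S,a₂]) = 1`
    have hT1 := ΦT a₁ ha₁ _ _ _ hΦa₁
    have hS2 := ΦS a₂ ha₂ _ _ _ hΦa₂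
    have hprod : (⟨⁅T, a₁⁆ * ⁅S, a₂⁆, mul_mem (hδmem T a₁ ha₁) (hδmem S a₂ ha₂)⟩ :
        Gamma M) = ⟨⁅T, a₁⁆, hδmem T a₁ ha₁⟩ * ⟨⁅S, a₂⁆, hδmem S a₂ ha₂⟩ := rfl
    have hone := P2 _ (mul_mem (hδmem T a₁ ha₁) (hδmem S a₂ ha₂)) hmem
    rw [hprod, map_mul, hT1, hS2, ← ofAdd_add, ← ofAdd_zero] at hone
    have heq := Multiplicative.ofAdd.injective hone
    simp only [Prod.mk_add_mk, Prod.mk_eq_zero] at heq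
    obtain ⟨e1, e2, e3⟩ := heq
    have rk : ((k : ℤ) : ZMod 2) = ((-i : ℤ) : ZMod 2) := by
      push_cast
      linear_combination (-1 : ZMod 2) * e1 + ((i' : ℤ) : ZMod 2) * h20
    have rj' : ((k' : ℤ) : ZMod 2) = ((j' : ℤ) : ZMod 2) := by
      linear_combination e3
    -- `2`-torsion of the basic values
    have tT : ∀ a ∈ Gamma M, π ⁅T, a⁆ ^ 2 = 1 := fun a ha ↦ hδtors T a ha
    have tS : ∀ a ∈ Gamma M, π ⁅S, a⁆ ^ 2 = 1 := fun a ha ↦ hδtors S a ha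
    -- expand
    refine ⟨-i - i', ?_⟩
    rw [hδcongr T a₁ _ ha₁ hg₁ h1, hδcongr S a₂ _ ha₂ hg₂ h2,
      hδmul T _ _ (mul_mem (zpow_mem mH i) (zpow_mem mE j)) (zpow_mem mF k),
      hδmul T _ _ (zpow_mem mH i) (zpow_mem mE j),
      hδmul S _ _ (mul_mem (zpow_mem mH i') (zpow_mem mE j')) (zpow_mem mF k'),
      hδmul S _ _ (zpow_mem mH i') (zpow_mem mE j'),
      hδzpow T uH mH, hδzpow T uE mE, hδzpow T uF mF, hδzpow S uH mH, hδzpow S uE mE, hδzpow S uF mF, ζE,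
      one_zpow, mul_one, ζF, inv_zpow', hzmod _ (tT uF mF) k (-i) rk,
      hzmod _ (tS uE mE) (-k') (-j') (by push_cast; rw [rj']), mul_assoc (π ⁅S, uH⁆ ^ i'),
      ← zpow_add, add_neg_cancel, zpow_zero, mul_one, hzS, inv_zpow', sub_eq_add_neg, zpow_add]
    congr 1
    rw [hwpow (-i)]
    simp only [zpow_neg, inv_inv]
    exact ((Commute.zpow_zpow cTH i i).inv_right).eq
  -- conclusion
  refine ⟨hgh₀ T, hT2, ?_⟩
  intro y hy hyc
  have hyc' : y ∈ ⁅(⊤ : Subgroup SL(2, ℤ)), Gamma M⁆ ⊔ K := hyc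
  rw [Subgroup.mem_sup_of_normal_right] at hyc'
  obtain ⟨u, hu, v, hv, huv⟩ := hyc'
  obtain ⟨a₁, a₂, ha₁, ha₂, hπu⟩ := hyM u hu
  have hv1 : π v = 1 := by
    rw [hπ, QuotientGroup.mk'_apply]; exact (QuotientGroup.eq_one_iff v).mpr hv
  have hπy : π y = π ⁅T, a₁⁆ * π ⁅S, a₂⁆ := by rw [← huv, map_mul, hv1, mul_one, hπu]
  have hcmem : ⁅T, a₁⁆ * ⁅S, a₂⁆ ∈ Gamma (M * 2) := by
    have h1 : (⁅T, a₁⁆ * ⁅S, a₂⁆)⁻¹ * y ∈ Gamma (M * 2) := by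
      apply hZmem; rw [map_mul, map_inv, map_mul, hπy, inv_mul_cancel]
    have h2 := mul_mem hy (inv_mem h1)
    rwa [show y * ((⁅T, a₁⁆ * ⁅S, a₂⁆)⁻¹ * y)⁻¹ = ⁅T, a₁⁆ * ⁅S, a₂⁆ by group] at h2
  obtain ⟨i, hval⟩ := hclaim a₁ a₂ ha₁ ha₂ hcmem
  refine ⟨i, ?_⟩
  have hπy' : π y = π (⁅T, h₀⁆ ^ i) := by rw [hπy, hval, map_zpow]
  have h3 : (⟨⁅T, h₀⁆ ^ i, zpow_mem (hgh₀ T) i⟩ : Gamma (M * 2)) = ⟨⁅T, h₀⁆, hgh₀ T⟩ ^ i := rfl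
  rw [hπθ y _ hy (zpow_mem (hgh₀ T) i) hπy', h3, map_zpow]

end UnboundedDenominators

end Literature.NumberTheory.Automorphic
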